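import Summits.SmoothPoincare4.SmoothPoincare4.Theorems.ConvexBisectionPlanarAcyclicBisectionRigidityHelperAbelianArcData
import HarnessLib

/-!
# Crux `ConvexBisection.PlanarAcyclicBisectionRigidity`, line Sketch — helper
# `helper_unimodular_transfer`

Item stmt-SmoothPoincare4-15086, skeleton `Cruxes/PlanarAcyclicBisectionRigidity/Lines/Sketch.lean`
v3.0 (lead c3), stub `stub_unimodularTransfer`.  **Gram transfer of unimodularity**: two positive
factorisations `A`, `B` of ONE mapping class of the disc with `n` holes (equal arc data
`monodromy`), `n` curves each — if the hole-set matrix of `A` is unimodular then so is that of `B`.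
Pure algebra over the registered word calculus `Literature.Topology.FourManifolds.PlanarWords` and
the landed abelianised arc data `AbArc` (`…HelperAbelianArcData.lean`); nothing topological is
assumed, no named fact is used.

Proof.  `Unimodular n A` is "the `0/1` type vectors `typeVec n c`, `c ∈ A`, generate `ℤⁿ`"
(`AbArc.unimodular_of_span_typeVec_eq_top` and its converse `span_typeVec_eq_top_of_unimodular`
below, through `F_nᵃᵇ ≅ ℤⁿ`, `AbArc.evAb`).  Stack the `n` type vectors of `A` as the rows of a
square integer matrix `H_A`; its rows span `ℤⁿ` iff `v ↦ v ᵥ* H_A` is onto iff `H_A`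
is invertible iff `det H_A` is a unit (`range_vecMulLinear`, `Matrix.vecMul_surjective_iff_isUnit`,
`Matrix.isUnit_iff_isUnit_det`).  Equal monodromies give equal Gram matrices
`H_Aᵀ H_A = H_Bᵀ H_B` (`AbArc.gram_eq_of_monodromy_eq`), so `(det H_B)² = (det H_A)²` is a unit,
hence so is `det H_B`, and the rows of `H_B` span `ℤⁿ`.
-/

noncomputable section

open Literature.Topology.FourManifolds Literature.Topology.FourManifolds.PlanarWords

-- the prescribed namespace `Summit.<S>.<P>.…` repeats `SmoothPoincare4` (S = P = SmoothPoincare4)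
set_option linter.dupNamespace false

namespace Summit.SmoothPoincare4.SmoothPoincare4.Theorems.PlanarAcyclicBisectionRigidity.Sketch

namespace UniTransfer

open Matrix AbArc

/-! ## Square integer matrices from lists of `n` vectors of `ℤⁿ` -/

/-- A sum over a list, re-indexed by `Fin m` through a length identity `L.length = m`.
[folklore] -/
theorem sum_fin_eq_sum_map {α M : Type*} [AddCommMonoid M] (L : List α) {m : ℕ}
    (h : L.length = m) (f : α → M) :
    ∑ k : Fin m, f (L.get (k.cast h.symm)) = (L.map f).sum := by
  subst h
  simp [Fin.sum_univ_fun_getElem]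

variable {n : ℕ}

/-- The rows of the square matrix `Matrix.of fun k => L.get (k.cast h.symm)` of a list `L` of `n`
vectors are exactly the members of `L`. [folklore] -/
theorem range_row_of_get (L : List (Fin n → ℤ)) (h : L.length = n) :
    Set.range (Matrix.of fun k : Fin n => L.get (k.cast h.symm)).row = {s | s ∈ L} := by
  ext s
  simp only [Set.mem_range, Set.mem_setOf_eq, Matrix.row_def]
  constructor
  · rintro ⟨k, rfl⟩
    exact List.get_mem L _
  · intro hs
    obtain ⟨i, rfl⟩ := List.get_of_mem hs
    exact ⟨i.cast h, rfl⟩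

/-- The Gram matrix of the rows: `(Hᵀ H) i j = Σ_{s ∈ L} sᵢ sⱼ`. [folklore] -/
theorem transpose_mul_self_of_get_apply (L : List (Fin n → ℤ)) (h : L.length = n) (i j : Fin n) :
    ((Matrix.of fun k : Fin n => L.get (k.cast h.symm))ᵀ
      * Matrix.of fun k : Fin n => L.get (k.cast h.symm)) i j = (L.map fun s => s i * s j).sum := by
  rw [Matrix.mul_apply]
  simp only [Matrix.transpose_apply, Matrix.of_apply]
  exact sum_fin_eq_sum_map L h (fun s => s i * s j)

/-- **`n` vectors span `ℤⁿ` iff their matrix has unit determinant**: the rows of `H` span iff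
`v ↦ v ᵥ* H` is onto iff `H` is invertible over `ℤ`. [folklore] -/
theorem span_eq_top_iff_isUnit_det (L : List (Fin n → ℤ)) (h : L.length = n) :
    Submodule.span ℤ {s | s ∈ L} = ⊤
      ↔ IsUnit (Matrix.of fun k : Fin n => L.get (k.cast h.symm)).det := by
  rw [← range_row_of_get L h, ← range_vecMulLinear, LinearMap.range_eq_top,
    Matrix.coe_vecMulLinear, Matrix.vecMul_surjective_iff_isUnit, Matrix.isUnit_iff_isUnit_det]

/-- **Gram transfer for square families**: two lists of `n` vectors of `ℤⁿ` with the same Gram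
matrix span `ℤⁿ` simultaneously (`(det H_B)² = det (H_Bᵀ H_B) = det (H_Aᵀ H_A) = (det H_A)²`).
[folklore] -/
theorem span_eq_top_of_gram_eq (sA sB : List (Fin n → ℤ)) (hA : sA.length = n)
    (hB : sB.length = n)
    (hgram : ∀ i j : Fin n, (sA.map fun s => s i * s j).sum = (sB.map fun s => s i * s j).sum)
    (hspan : Submodule.span ℤ {s | s ∈ sA} = ⊤) : Submodule.span ℤ {s | s ∈ sB} = ⊤ := by
  set HA : Matrix (Fin n) (Fin n) ℤ := Matrix.of fun k : Fin n => sA.get (k.cast hA.symm) with hHA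
  set HB : Matrix (Fin n) (Fin n) ℤ := Matrix.of fun k : Fin n => sB.get (k.cast hB.symm) with hHB
  have hG : HAᵀ * HA = HBᵀ * HB := by
    ext i j
    rw [hHA, hHB, transpose_mul_self_of_get_apply sA hA, transpose_mul_self_of_get_apply sB hB,
      hgram]
  have hdet : HA.det * HA.det = HB.det * HB.det := by
    simpa only [Matrix.det_mul, Matrix.det_transpose] using congrArg Matrix.det hG
  rw [span_eq_top_iff_isUnit_det sA hA] at hspan
  rw [span_eq_top_iff_isUnit_det sB hB]
  have h2 : IsUnit (HB.det * HB.det) := hdet ▸ hspan.mul hspan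
  exact isUnit_of_mul_isUnit_left h2

/-! ## `Unimodular n A` is "the types of `A` span `ℤⁿ`" (converse direction) -/

/-- The abelianised exponent-sum map `evAb : F_nᵃᵇ → ℤⁿ` is onto. [folklore] -/
theorem evAb_surjective : Function.Surjective (evAb n) := by
  intro v
  obtain ⟨x, hx⟩ := evHom_surjective v
  exact ⟨Abelianization.of x, by rw [← hx]; rfl⟩

/-- **`Unimodular n A` gives "the types of `A` span `ℤⁿ`"** (converse of
`AbArc.unimodular_of_span_typeVec_eq_top`): push `Subgroup.closure = ⊤` in `F_nᵃᵇ` through the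
surjection `evAb` onto `ℤⁿ` and read a subgroup of `ℤⁿ` as a `ℤ`-submodule. [folklore] -/
theorem span_typeVec_eq_top_of_unimodular (A : List PlanarCurve) (h : Unimodular n A) :
    Submodule.span ℤ {s | s ∈ A.map (typeVec n)} = ⊤ := by
  set S : Set (Abelianization (FreeGroup (Fin n))) :=
    {x | x ∈ A.map fun c => Abelianization.of (PlanarCurve.cls n c)} with hS
  have hcl : Subgroup.closure ((evAb n) '' S) = ⊤ := by
    rw [← MonoidHom.map_closure, show Subgroup.closure S = ⊤ from h,
      Subgroup.map_top_of_surjective _ evAb_surjective]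
  rw [Submodule.eq_top_iff']
  intro v
  have hv : Multiplicative.ofAdd v ∈ Subgroup.closure ((evAb n) '' S) := by
    rw [hcl]; trivial
  refine Subgroup.closure_induction
    (p := fun y _ => Multiplicative.toAdd y ∈ Submodule.span ℤ {s | s ∈ A.map (typeVec n)})
    ?_ ?_ ?_ ?_ hv
  · rintro y ⟨x, hx, rfl⟩
    refine Submodule.subset_span ?_
    simp only [hS, List.mem_map, Set.mem_setOf_eq] at hx ⊢
    obtain ⟨c, hc, rfl⟩ := hx
    exact ⟨c, hc, rfl⟩
  · simp
  · intro y z _ _ hy hz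
    simpa [toAdd_mul] using Submodule.add_mem _ hy hz
  · intro y _ hy
    simpa [toAdd_inv] using Submodule.neg_mem _ hy

end UniTransfer

open AbArc UniTransfer in
/-- **GRAM TRANSFER OF UNIMODULARITY (registered stub `stub_unimodularTransfer`, skeleton v3.0).**
For two positive factorisations `A`, `B` of one mapping class on `n` holes (equal arc data), `n`
letters each: if the hole matrix of `A` is unimodular then so is that of `B`.  Abelianise
(`AbArc`): `Unimodular` is "the types span `ℤⁿ`", i.e. `det H = ±1` for the square matrix of
types; equal monodromies give `H_Aᵀ H_A = H_Bᵀ H_B`, so `(det H_B)² = (det H_A)² = 1`.  The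
in-range hypothesis is part of the registered signature but is not needed. [folklore] -/
theorem helper_unimodular_transfer (n : ℕ) (A B : List PlanarCurve) (hin : ∀ c ∈ A ++ B, c.InRange n)
    (hA : A.length = n) (hB : B.length = n)
    (hmon : monodromy n (positiveWord A) = monodromy n (positiveWord B)) (huA : Unimodular n A) :
    Unimodular n B := by
  -- the in-range hypothesis `hin` of the registered signature is not needed by the algebra
  have _ := hin
  exact unimodular_of_span_typeVec_eq_top B
    (span_eq_top_of_gram_eq (A.map (typeVec n)) (B.map (typeVec n))
      (by rw [List.length_map, hA]) (by rw [List.length_map, hB])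
      (gram_eq_of_monodromy_eq A B hmon) (span_typeVec_eq_top_of_unimodular A huA))

end Summit.SmoothPoincare4.SmoothPoincare4.Theorems.PlanarAcyclicBisectionRigidity.Sketch

end
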